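import Summits.KontsevichZagierPeriods.KontsevichZagierPeriods.Theorems.TerasomaMultiplicationMultiplicationThreeStubBoxToSigmaBoxAvgAux
import Summits.KontsevichZagierPeriods.KontsevichZagierPeriods.Theses.TerasomaMultiplication
import Summits.KontsevichZagierPeriods.KontsevichZagierPeriods.Theorems.MultiplicationThree.Negative.Pinned
import Summits.KontsevichZagierPeriods.KontsevichZagierPeriods.Theorems.MultiplicationThree.Negative.BolzaLever
import Literature.NumberTheory.Transcendental.KZMellinFibres
import Literature.NumberTheory.Transcendental.KZSubcalculusInvariants
import Literature.NumberTheory.Transcendental.KZDominatedFamilyRelations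
import Literature.NumberTheory.Transcendental.KZLogCalculusProofs
import Literature.NumberTheory.Transcendental.KZSemialgebraicComplex
import Mathlib.Analysis.SpecialFunctions.Pow.Deriv

/-!
# `MultiplicationThree` (stmt-KontsevichZagierPeriods-3598), line `bolza-involution-real-quotient`:
# stub S1 — steps 0 + (i): shear of the box onto `Σ_box` and the involution average

Stub `stub_boxToSigmaBoxAvg` of the crux `MultiplicationThree` (route `TerasomaMultiplication`; lead skeleton
`Cruxes/MultiplicationThree/Lines/bolza-involution-real-quotient.lean`).

With `u = x 0`, `v = x 1`, `Σ_box = {0 < u, 0 < v, v < 1 − u}`, `ψ = v^{−2/3}(1−v)^{−2/3}(1−u−v)^{−1/3}`,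
`ψ̄ = v^{−1/3}(1−v)^{−1/3}(1−u−v)^{−2/3}` (maps and Jacobian identities in the auxiliary file
`…StubBoxToSigmaBoxAvgAux.lean`: the coarea shear `Ψ(v₁,v₂) = ((1−v₁)(1−v₂), v₁)` of the box onto
`Σ_box`, `|det DΨ| = 1 − v₁`, rule-(2) instance `s1_box_shear_move`; the involution
`ι(u,v) = (u,(1−u−v)/(1−v))` of `Σ_box`, `|det Dι| = u/(1−v)²`, rule-(2) instance
`s1_involution_move`), this file proves, for every rational `s > 0`:

* existence of the sheared representations `[Σ_box, u^{s−1}ψ]` (integrability transported from the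
  pinned box representation `boxRep` of `Negative/Pinned.lean` through `Ψ` by the Jacobian criterion
  `integrableOn_image_iff_integrableOn_abs_det_fderiv_smul`; `ℚ`-semialgebraic as an Euler–Mellin
  integrand), `[Σ_box, u^{s−1}ψ̄]` (through `ι`) and `[Σ_box, u^{s−1}(ψ+ψ̄)/2]`;
* `s1_boxRep_equivalent_avg`: `boxRep s ~ ρ` for every `ρ = [Σ_box, u^{s−1}(ψ+ψ̄)/2]` — the shear
  (rule 2), halving (rule 1b), the involution on one half (rule 2), re-addition (rule 1b);
* the registered stub `stub_boxToSigmaBoxAvg`: for every `r` pinned to the box data such a `ρ`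
  exists and `r ~ ρ` for every such `ρ` (`r ~ boxRep s` by the pinning lemma
  `KZ.of_sub_of_mem_relations_of_eqOn`).

Pure proof file: no definitions are introduced (the densities are written out). (The standing
disprover's certified §9 of `Cruxes/MultiplicationThree/Disproof.lean`.)

References: M. Kontsevich, D. Zagier, *Periods* (2001), §1.2 rules (1), (2).
-/

noncomputable section

open Set MeasureTheory MvPolynomial Real
open scoped BigOperators
open Literature.NumberTheory.Transcendental Literature.NumberTheory.Transcendental.KZ
open Literature.ModelTheory.ExponentialFields (IsSemialgebraic)

namespace Summit.KontsevichZagierPeriods.TerasomaMultiplication.MultiplicationThreeBolza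

open Summit.KontsevichZagierPeriods.TerasomaMultiplication.MultiplicationThreeNegative

/-! ### Existence of the sheared representations (integrability transported from the box) -/

/-- `Σ_box` is measurable. [folklore] -/
theorem s1_measurableSet_sigmaBox :
    MeasurableSet {x : Fin 2 → ℝ | 0 < x 0 ∧ 0 < x 1 ∧ x 1 < 1 - x 0} :=
  IsSemialgebraic.measurableSet_holds s1_isSemialgebraic_sigmaBox

/-- `u^{s−1}ψ` is integrable on `Σ_box` (transported from the box through the shear). [folklore] -/
theorem s1_integrableOn_psi {s : ℚ} (hs : 0 < s) :
    IntegrableOn (fun x : Fin 2 → ℝ => x 0 ^ ((s:ℝ) - 1) *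
        (x 1 ^ (-(2:ℝ)/3) * (1 - x 1) ^ (-(2:ℝ)/3) * (1 - x 0 - x 1) ^ (-(1:ℝ)/3)))
      {x : Fin 2 → ℝ | 0 < x 0 ∧ 0 < x 1 ∧ x 1 < 1 - x 0} := by
  have key : IntegrableOn (fun x => |((fun x : Fin 2 → ℝ => LinearMap.toContinuousLinearMap
        (Matrix.toLin' !![-(1 - x 1), -(1 - x 0); (1:ℝ), 0])) x).det| •
      (fun x : Fin 2 → ℝ => x 0 ^ ((s:ℝ) - 1) *
          (x 1 ^ (-(2:ℝ)/3) * (1 - x 1) ^ (-(2:ℝ)/3) * (1 - x 0 - x 1) ^ (-(1:ℝ)/3)))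
        ((fun x : Fin 2 → ℝ => (![(1 - x 0) * (1 - x 1), x 0] : Fin 2 → ℝ)) x)) box := by
    refine (integrableOn_boxFun hs).congr_fun (fun x hx => ?_) measurableSet_box
    rw [s1_boxFun_eq_shear_jacobian hx, smul_eq_mul, mul_comm]
  have h := (integrableOn_image_iff_integrableOn_abs_det_fderiv_smul volume measurableSet_box
    (fun x _ => (s1_hasFDerivAt_shear x).hasFDerivWithinAt) s1_injOn_shear
    (fun x : Fin 2 → ℝ => x 0 ^ ((s:ℝ) - 1) *
      (x 1 ^ (-(2:ℝ)/3) * (1 - x 1) ^ (-(2:ℝ)/3) * (1 - x 0 - x 1) ^ (-(1:ℝ)/3)))).mpr key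
  rwa [s1_image_shear_box] at h

/-- `u^{s−1}ψ` is `ℚ`-semialgebraic on `Σ_box` (an Euler–Mellin integrand). [folklore] -/
theorem s1_isSemialgebraicFunOn_psi (s : ℚ) :
    IsSemialgebraicFunOn ℚ {x : Fin 2 → ℝ | 0 < x 0 ∧ 0 < x 1 ∧ x 1 < 1 - x 0}
      (fun x : Fin 2 → ℝ => x 0 ^ ((s:ℝ) - 1) *
        (x 1 ^ (-(2:ℝ)/3) * (1 - x 1) ^ (-(2:ℝ)/3) * (1 - x 0 - x 1) ^ (-(1:ℝ)/3))) := by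
  have hmel := isSemialgebraicFunOn_mellinIntegrand s1_isSemialgebraic_sigmaBox
    (![X 0, X 1, 1 - X 1, 1 - X 0 - X 1] : Fin 4 → MvPolynomial (Fin 2) ℚ)
    (![s - 1, -2/3, -2/3, -1/3]) 1 ?_
  · refine hmel.congr fun x _ => ?_
    simp only [mellinIntegrand, Fin.prod_univ_four, Matrix.cons_val_zero, Matrix.cons_val_one,
      Matrix.cons_val, map_sub, map_one, MvPolynomial.aeval_X, Rat.cast_sub,
      Rat.cast_one, Rat.cast_div, Rat.cast_neg, Rat.cast_ofNat]
    ring_nf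
  · intro x hx k
    obtain ⟨h0, h1, h2⟩ := hx
    fin_cases k <;> simp <;> linarith

/-- **The sheared box representation** `[Σ_box, u^{s−1}ψ]` exists. [folklore] -/
theorem s1_exists_psiRep {s : ℚ} (hs : 0 < s) :
    ∃ R : IntegralRep 2, R.domain = {x : Fin 2 → ℝ | 0 < x 0 ∧ 0 < x 1 ∧ x 1 < 1 - x 0} ∧
      R.integrand = fun x : Fin 2 → ℝ => x 0 ^ ((s:ℝ) - 1) *
        (x 1 ^ (-(2:ℝ)/3) * (1 - x 1) ^ (-(2:ℝ)/3) * (1 - x 0 - x 1) ^ (-(1:ℝ)/3)) :=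
  ⟨⟨{x : Fin 2 → ℝ | 0 < x 0 ∧ 0 < x 1 ∧ x 1 < 1 - x 0},
    fun x : Fin 2 → ℝ => x 0 ^ ((s:ℝ) - 1) *
      (x 1 ^ (-(2:ℝ)/3) * (1 - x 1) ^ (-(2:ℝ)/3) * (1 - x 0 - x 1) ^ (-(1:ℝ)/3)),
    s1_isSemialgebraic_sigmaBox, s1_isSemialgebraicFunOn_psi s, s1_integrableOn_psi hs⟩, rfl, rfl⟩

/-- `u^{s−1}ψ̄` is integrable on `Σ_box` (transported through the involution). [folklore] -/
theorem s1_integrableOn_psiBar {s : ℚ} (hs : 0 < s) :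
    IntegrableOn (fun x : Fin 2 → ℝ => x 0 ^ ((s:ℝ) - 1) *
        (x 1 ^ (-(1:ℝ)/3) * (1 - x 1) ^ (-(1:ℝ)/3) * (1 - x 0 - x 1) ^ (-(2:ℝ)/3)))
      {x : Fin 2 → ℝ | 0 < x 0 ∧ 0 < x 1 ∧ x 1 < 1 - x 0} := by
  have himg : IntegrableOn (fun x : Fin 2 → ℝ => x 0 ^ ((s:ℝ) - 1) *
        (x 1 ^ (-(2:ℝ)/3) * (1 - x 1) ^ (-(2:ℝ)/3) * (1 - x 0 - x 1) ^ (-(1:ℝ)/3)))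
      ((fun x : Fin 2 → ℝ => (![x 0, (1 - x 0 - x 1) / (1 - x 1)] : Fin 2 → ℝ)) ''
        {x : Fin 2 → ℝ | 0 < x 0 ∧ 0 < x 1 ∧ x 1 < 1 - x 0}) := by
    rw [s1_image_iota]; exact s1_integrableOn_psi hs
  have h := (integrableOn_image_iff_integrableOn_abs_det_fderiv_smul volume
    s1_measurableSet_sigmaBox (fun x hx => (s1_hasFDerivAt_iota
      (by obtain ⟨h0, -, h2⟩ := hx; linarith)).hasFDerivWithinAt) s1_injOn_iota
    (fun x : Fin 2 → ℝ => x 0 ^ ((s:ℝ) - 1) *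
      (x 1 ^ (-(2:ℝ)/3) * (1 - x 1) ^ (-(2:ℝ)/3) * (1 - x 0 - x 1) ^ (-(1:ℝ)/3)))).mp himg
  refine h.congr_fun (fun x hx => ?_) s1_measurableSet_sigmaBox
  have e := s1_psiBar_eq_jacobian (s := s) hx
  rw [mul_comm] at e
  exact e.symm

/-- `u^{s−1}ψ̄` is `ℚ`-semialgebraic on `Σ_box`. [folklore] -/
theorem s1_isSemialgebraicFunOn_psiBar (s : ℚ) :
    IsSemialgebraicFunOn ℚ {x : Fin 2 → ℝ | 0 < x 0 ∧ 0 < x 1 ∧ x 1 < 1 - x 0}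
      (fun x : Fin 2 → ℝ => x 0 ^ ((s:ℝ) - 1) *
        (x 1 ^ (-(1:ℝ)/3) * (1 - x 1) ^ (-(1:ℝ)/3) * (1 - x 0 - x 1) ^ (-(2:ℝ)/3))) := by
  have hmel := isSemialgebraicFunOn_mellinIntegrand s1_isSemialgebraic_sigmaBox
    (![X 0, X 1, 1 - X 1, 1 - X 0 - X 1] : Fin 4 → MvPolynomial (Fin 2) ℚ)
    (![s - 1, -1/3, -1/3, -2/3]) 1 ?_
  · refine hmel.congr fun x _ => ?_
    simp only [mellinIntegrand, Fin.prod_univ_four, Matrix.cons_val_zero,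
      Matrix.cons_val_one, Matrix.cons_val, map_sub, map_one, MvPolynomial.aeval_X, Rat.cast_sub,
      Rat.cast_one, Rat.cast_div, Rat.cast_neg, Rat.cast_ofNat]
    ring_nf
  · intro x hx k
    obtain ⟨h0, h1, h2⟩ := hx
    fin_cases k <;> simp <;> linarith

/-- **The conjugate sheared representation** `[Σ_box, u^{s−1}ψ̄]` exists. [folklore] -/
theorem s1_exists_psiBarRep {s : ℚ} (hs : 0 < s) :
    ∃ R : IntegralRep 2, R.domain = {x : Fin 2 → ℝ | 0 < x 0 ∧ 0 < x 1 ∧ x 1 < 1 - x 0} ∧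
      R.integrand = fun x : Fin 2 → ℝ => x 0 ^ ((s:ℝ) - 1) *
        (x 1 ^ (-(1:ℝ)/3) * (1 - x 1) ^ (-(1:ℝ)/3) * (1 - x 0 - x 1) ^ (-(2:ℝ)/3)) :=
  ⟨⟨{x : Fin 2 → ℝ | 0 < x 0 ∧ 0 < x 1 ∧ x 1 < 1 - x 0},
    fun x : Fin 2 → ℝ => x 0 ^ ((s:ℝ) - 1) *
      (x 1 ^ (-(1:ℝ)/3) * (1 - x 1) ^ (-(1:ℝ)/3) * (1 - x 0 - x 1) ^ (-(2:ℝ)/3)),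
    s1_isSemialgebraic_sigmaBox, s1_isSemialgebraicFunOn_psiBar s, s1_integrableOn_psiBar hs⟩,
    rfl, rfl⟩

/-- **The averaged sheared representation** `[Σ_box, u^{s−1}(ψ + ψ̄)/2]` exists. [folklore] -/
theorem s1_exists_avgRep {s : ℚ} (hs : 0 < s) :
    ∃ ρ : IntegralRep 2, ρ.domain = {x : Fin 2 → ℝ | 0 < x 0 ∧ 0 < x 1 ∧ x 1 < 1 - x 0} ∧
      ρ.integrand = fun x => ((x 0) ^ ((s:ℝ) - 1) * ((x 1) ^ (-(2:ℝ)/3) * (1 - x 1) ^ (-(2:ℝ)/3) *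
        (1 - x 0 - x 1) ^ (-(1:ℝ)/3)) + (x 0) ^ ((s:ℝ) - 1) * ((x 1) ^ (-(1:ℝ)/3) *
        (1 - x 1) ^ (-(1:ℝ)/3) * (1 - x 0 - x 1) ^ (-(2:ℝ)/3))) / 2 := by
  have half : IsAlgebraic ℚ ((1/2 : ℚ) : ℝ) := isAlgebraic_algebraMap _
  have hsa : IsSemialgebraicFunOn ℚ {x : Fin 2 → ℝ | 0 < x 0 ∧ 0 < x 1 ∧ x 1 < 1 - x 0}
      fun x => ((x 0) ^ ((s:ℝ) - 1) * ((x 1) ^ (-(2:ℝ)/3) * (1 - x 1) ^ (-(2:ℝ)/3) *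
        (1 - x 0 - x 1) ^ (-(1:ℝ)/3)) + (x 0) ^ ((s:ℝ) - 1) * ((x 1) ^ (-(1:ℝ)/3) *
        (1 - x 1) ^ (-(1:ℝ)/3) * (1 - x 0 - x 1) ^ (-(2:ℝ)/3))) / 2 :=
    (IsSemialgebraicFunOn.mul_holds
      (isSemialgebraicFunOn_const_of_isAlgebraic s1_isSemialgebraic_sigmaBox half)
      (IsSemialgebraicFunOn.add_holds (s1_isSemialgebraicFunOn_psi s)
        (s1_isSemialgebraicFunOn_psiBar s))).congr fun x _ => by
      simp only [Pi.mul_apply, Pi.add_apply]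
      push_cast
      ring
  exact ⟨⟨{x : Fin 2 → ℝ | 0 < x 0 ∧ 0 < x 1 ∧ x 1 < 1 - x 0}, _, s1_isSemialgebraic_sigmaBox, hsa,
    ((s1_integrableOn_psi hs).add (s1_integrableOn_psiBar hs)).div_const 2⟩, rfl, rfl⟩

/-! ### Step (i) certified: `[box] ~ [Σ_box, u^{s−1}(ψ+ψ̄)/2]` -/

/-- **Step (i) of the bolza chain, certified**: for every rational `s > 0` and every representation
`ρ` on `Σ_box` with integrand `u^{s−1}(ψ+ψ̄)/2` there, `boxRep s ~ ρ` — by the shear (rule 2),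
halving (rule 1b), the involution on one half (rule 2) and re-addition (rule 1b).
[cite: KontsevichZagier2001, §1.2 rules (1), (2)] [folklore] -/
theorem s1_boxRep_equivalent_avg {s : ℚ} (hs : 0 < s) (ρ : IntegralRep 2)
    (hρ : ρ.domain = {x : Fin 2 → ℝ | 0 < x 0 ∧ 0 < x 1 ∧ x 1 < 1 - x 0})
    (hρi : EqOn ρ.integrand (fun x => ((x 0) ^ ((s:ℝ) - 1) * ((x 1) ^ (-(2:ℝ)/3) *
      (1 - x 1) ^ (-(2:ℝ)/3) * (1 - x 0 - x 1) ^ (-(1:ℝ)/3)) + (x 0) ^ ((s:ℝ) - 1) *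
      ((x 1) ^ (-(1:ℝ)/3) * (1 - x 1) ^ (-(1:ℝ)/3) * (1 - x 0 - x 1) ^ (-(2:ℝ)/3))) / 2) ρ.domain) :
    Equivalent (boxRep s hs) ρ := by
  obtain ⟨R, hRd, hRi⟩ := s1_exists_psiRep hs
  obtain ⟨B, hBd, hBi⟩ := s1_exists_psiBarRep hs
  have half : IsAlgebraic ℚ ((1/2 : ℚ) : ℝ) := isAlgebraic_algebraMap _
  -- [box] ~ [Σ, ψ]  (the shear, rule 2)
  have h0 : of (boxRep s hs) - of R ∈ relations :=
    changeOfVariablesRel_subset_relations (s1_box_shear_move hs R hRd fun x _ => congrFun hRi x)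
  -- [Σ, ψ] = [Σ, ψ/2] + [Σ, ψ/2]  (rule 1b)
  have h1 : of R - of (R.constMul _ half) - of (R.constMul _ half) ∈ relations :=
    integrandAddRel_subset_relations ⟨2, R, R.constMul _ half, R.constMul _ half, rfl, rfl,
      fun x _ => by
        simp only [IntegralRep.integrand_constMul, Pi.add_apply]
        push_cast
        ring, rfl⟩
  -- [Σ, ψ̄/2] ~ [Σ, ψ/2]  (the involution, rule 2)
  have h2 : of (B.constMul _ half) - of (R.constMul _ half) ∈ relations :=
    changeOfVariablesRel_subset_relations (s1_involution_move (s := s) ((1/2 : ℚ) : ℝ)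
      (B.constMul _ half) (R.constMul _ half) (by rw [IntegralRep.domain_constMul, hBd])
      (fun x _ => by simp only [IntegralRep.integrand_constMul, hBi])
      (by rw [IntegralRep.domain_constMul, hRd])
      (fun x _ => by simp only [IntegralRep.integrand_constMul, hRi]))
  -- [ρ] = [Σ, ψ/2] + [Σ, ψ̄/2]  (rule 1b)
  have h3 : of ρ - of (R.constMul _ half) - of (B.constMul _ half) ∈ relations :=
    integrandAddRel_subset_relations ⟨2, ρ, R.constMul _ half, B.constMul _ half,
      by rw [IntegralRep.domain_constMul, hRd, hρ], by rw [IntegralRep.domain_constMul, hBd, hρ],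
      fun x hx => by
        rw [hρi hx]
        simp only [IntegralRep.integrand_constMul, Pi.add_apply, hRi, hBi]
        push_cast
        ring, rfl⟩
  show of (boxRep s hs) - of ρ ∈ relations
  have key : of (boxRep s hs) - of ρ = (of (boxRep s hs) - of R) +
      (of R - of (R.constMul _ half) - of (R.constMul _ half)) -
      (of (B.constMul _ half) - of (R.constMul _ half)) -
      (of ρ - of (R.constMul _ half) - of (B.constMul _ half)) := by
    abel
  rw [key]
  exact relations.sub_mem (relations.sub_mem (relations.add_mem h0 h1) h2) h3

/-! ### The registered stub -/

/-- **Stub S1 of the line `bolza-involution-real-quotient`** (steps 0 + (i)). For every rational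
`s > 0` and every representation `r` pinned to the box data of the crux
(`r.domain = (0,1)²`, integrand `v₁^{-2/3}(1-v₁)^{s-1}v₂^{-1/3}(1-v₂)^{s-1}` on it):
(a) a representation `ρ = [Σ_box, u^{s−1}(ψ+ψ̄)/2]` exists (`s1_exists_avgRep`: integrability
transported from the box through the shear `Ψ` and the involution `ι`, semialgebraicity as
Euler–Mellin integrands), and (b) `r ~ ρ` for EVERY representation `ρ` pinned to these data:
`r ~ boxRep s` (pinning, rule 1b with a zero representation) and `boxRep s ~ ρ` by the shear
(rule 2), halving (rule 1b), the involution on one half (rule 2) and re-addition (rule 1b)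
(`s1_boxRep_equivalent_avg`). [cite: KontsevichZagier2001, §1.2 rules (1), (2)] [folklore] -/
theorem stub_boxToSigmaBoxAvg :
    ∀ s : ℚ, 0 < s → ∀ (r : Literature.NumberTheory.Transcendental.KZ.IntegralRep 2), r.domain = {x | ∀ i, x i ∈ Set.Ioo (0:ℝ) 1} → Set.EqOn r.integrand (fun x => (x 0) ^ (-(2:ℝ)/3) * (1 - x 0) ^ ((s:ℝ) - 1) * (x 1) ^ (-(1:ℝ)/3) * (1 - x 1) ^ ((s:ℝ) - 1)) r.domain → (∃ ρ : Literature.NumberTheory.Transcendental.KZ.IntegralRep 2, ρ.domain = {x | 0 < x 0 ∧ 0 < x 1 ∧ x 1 < 1 - x 0} ∧ Set.EqOn ρ.integrand (fun x => ((x 0) ^ ((s:ℝ) - 1) * ((x 1) ^ (-(2:ℝ)/3) * (1 - x 1) ^ (-(2:ℝ)/3) * (1 - x 0 - x 1) ^ (-(1:ℝ)/3)) + (x 0) ^ ((s:ℝ) - 1) * ((x 1) ^ (-(1:ℝ)/3) * (1 - x 1) ^ (-(1:ℝ)/3) * (1 - x 0 - x 1) ^ (-(2:ℝ)/3))) / 2)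 ρ.domain) ∧ ∀ (ρ : Literature.NumberTheory.Transcendental.KZ.IntegralRep 2), ρ.domain = {x | 0 < x 0 ∧ 0 < x 1 ∧ x 1 < 1 - x 0} → Set.EqOn ρ.integrand (fun x => ((x 0) ^ ((s:ℝ) - 1) * ((x 1) ^ (-(2:ℝ)/3) * (1 - x 1) ^ (-(2:ℝ)/3) * (1 - x 0 - x 1) ^ (-(1:ℝ)/3)) + (x 0) ^ ((s:ℝ) - 1) * ((x 1) ^ (-(1:ℝ)/3) * (1 - x 1) ^ (-(1:ℝ)/3) * (1 - x 0 - x 1) ^ (-(2:ℝ)/3))) / 2) ρ.domain → Literature.NumberTheory.Transcendental.KZ.Equivalent r ρ := by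
  intro s hs r hr hri
  have e0 : Equivalent r (boxRep s hs) :=
    of_sub_of_mem_relations_of_eqOn (by rw [hr]; rfl) hri
  obtain ⟨ρ₀, hρ₀d, hρ₀i⟩ := s1_exists_avgRep hs
  exact ⟨⟨ρ₀, hρ₀d, fun x _ => congrFun hρ₀i x⟩,
    fun ρ hρ hρi => e0.trans (s1_boxRep_equivalent_avg hs ρ hρ hρi)⟩

end Summit.KontsevichZagierPeriods.TerasomaMultiplication.MultiplicationThreeBolza

end
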